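import Literature.AlgebraicGeometry.Resolution.ResolutionOfSingularities
import Mathlib.AlgebraicGeometry.Morphisms.Finite
import Mathlib.AlgebraicGeometry.Morphisms.Proper
import Mathlib.AlgebraicGeometry.Morphisms.UnderlyingMap
import HarnessLib

/-!
# Purely inseparable morphisms of bounded exponent and Frobenius sandwiches

Topic: `Literature/AlgebraicGeometry/Resolution`. NOTIONS ONLY (no named facts, no debt): the
section-level rendering of "purely inseparable of exponent `≤ e`" for a morphism of schemes in
characteristic `p`, the resulting notion of a purely inseparable alteration of bounded exponent,
and Frobenius sandwiches (quotients of a regular variety by a `1`-foliation, seen from below).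

## Content

* `IsPurelyInseparableOfExponent q f` — for `f : X ⟶ Y`: every section `a` of `X` over an open
  `f ⁻¹(V)` has its `q`-th power in the image of `f^* : Γ(Y, V) → Γ(X, f ⁻¹ V)`. For `q = p ^ e`
  and `f` a finite dominant morphism of integral schemes of characteristic `p` this is the
  classical condition `𝒪_X ^ {p^e} ⊆ 𝒪_Y`, i.e. `f` is dominated by the `e`-th iterate of the
  Frobenius of `X` (Ekedahl: "of height `≤ e`"; Rudakov–Shafarevich for `e = 1`; for the field
  extension `k(X)/k(Y)` it says: purely inseparable of exponent `≤ e`, Bourbaki, A.V.§5). For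
  `q = 1` it says that every `f.app V` is surjective (`isPurelyInseparableOfExponent_one_iff`).
* `IsPurelyInseparableAlterationOfExponent q π` — `π : Y ⟶ X` proper and surjective, and finite
  and purely inseparable of exponent `q` over some dense open `U ⊆ X` (a purely inseparable
  alteration in the sense of Abramovich–Oort / Temkin 2013, Conj. 1.3.1, with the exponent of
  `k(Y)/k(X)` recorded on sections; compare `IsPurelyInseparableAlteration` in `Alterations.lean`,
  which records radiciality as universal injectivity and no exponent).
* `IsFrobeniusSandwich p Y` — `Y` receives a finite surjective morphism, purely inseparable of
  exponent `p`, from a regular integral scheme `X`; equivalently (for normal `Y` of finite type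
  over a field of characteristic `p`) `Y = X/𝓕` is the quotient of the regular variety `X` by a
  `1`-foliation `𝓕 ⊆ T_X`, sandwiched as `X → Y → X^{(p)}` (Ekedahl 1987 §1–2; Posva, §2.4–2.5
  "quotients by 1-foliations", Jacobson correspondence Thm. 2.5.12 as cited in arXiv:2405.05735
  p. 2).
* API (all proved, elementary): `isPurelyInseparableOfExponent_one_iff`,
  `IsPurelyInseparableOfExponent.of_dvd` (the exponent may be enlarged to any multiple).

## Sources

* T. Ekedahl, *Foliations and inseparable morphisms*, Proc. Sympos. Pure Math. 46.2 (1987)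
  139–149: §1 (height-one purely inseparable morphisms `X → Y` of normal varieties, `Y` between
  `X` and `X^{(1)}`), §2 (correspondence with `p`-closed foliations).
* A. N. Rudakov, I. R. Shafarevich, *Inseparable morphisms of algebraic surfaces*, Izv. 40 (1976):
  §1 (morphisms of height `1` and `p`-closed vector fields).
* Q. Posva, *Resolution of 1-foliation singularities on surfaces and threefolds*, arXiv:2405.05735,
  p. 2 (Jacobson correspondence, infinitesimal quotients `X/𝓕`), §3.2–3.3.
* M. Temkin, *Inseparable local uniformization*, J. Algebra 373 (2013), Conj. 1.3.1 p. 3 (purely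
  inseparable alterations; wording of the alteration notion).
-/

noncomputable section

open CategoryTheory AlgebraicGeometry TopologicalSpace

namespace Literature.AlgebraicGeometry.Resolution

universe u

/-- **Purely inseparable of exponent `q` (on sections).** For a morphism of schemes `f : X ⟶ Y`
and `q : ℕ`: for every open `V ⊆ Y` and every section `a ∈ Γ(X, f ⁻¹ V)` there is
`b ∈ Γ(Y, V)` with `f^*(b) = a ^ q`. With `q = p ^ e` in characteristic `p` this is
"`𝒪_X^{p^e} ⊆ 𝒪_Y`", i.e. `f` is of height `≤ e` (Ekedahl), and on function fields
"`k(X)/k(Y)` is purely inseparable of exponent `≤ e`". For `q = 1` it says that each `f.app V` is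
surjective. [cite: Ekedahl1987, §1 (height of a purely inseparable morphism; rendered on sections)] -/
def IsPurelyInseparableOfExponent (q : ℕ) {X Y : Scheme.{u}} (f : X ⟶ Y) : Prop :=
  ∀ (V : Y.Opens) (a : Γ(X, f ⁻¹ᵁ V)), ∃ b : Γ(Y, V), f.app V b = a ^ q

/-- **Purely inseparable alteration of exponent `q`.** `π : Y ⟶ X` is proper and surjective, and
over some dense open `U ⊆ X` it is finite and purely inseparable of exponent `q` on sections.
For integral `X`, `Y` of characteristic `p` and `q = p ^ e` this is an alteration whose function
field extension `k(Y)/k(X)` is purely inseparable of exponent `≤ e` (Temkin 2013, Conj. 1.3.1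
wording: "an alteration `f : Y → X` with … a purely inseparable extension `k(Y)/k(X)`"), the
exponent being recorded; `q = 1` forces `π` to be an isomorphism over `U`.
[cite: Temkin2013, Conj. 1.3.1, p. 3 (wording of "purely inseparable alteration"; exponent added)] -/
def IsPurelyInseparableAlterationOfExponent (q : ℕ) {Y X : Scheme.{u}} (π : Y ⟶ X) : Prop :=
  IsProper π ∧ Surjective π ∧
    ∃ U : X.Opens, Dense (U : Set X) ∧ IsFinite (π ∣_ U) ∧
      IsPurelyInseparableOfExponent q (π ∣_ U)

/-- **Frobenius sandwich** (seen from below). A scheme `Y` is a Frobenius sandwich in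
characteristic `p` if it receives a finite surjective morphism `f : X ⟶ Y`, purely inseparable of
exponent `p` on sections (`𝒪_X^p ⊆ 𝒪_Y`), from a regular integral scheme `X`. For `Y` normal of
finite type over a field of characteristic `p` this says `Y = X/𝓕` for a `1`-foliation
`𝓕 ⊆ T_X` on the regular variety `X` (Jacobson–Ekedahl correspondence), `X → Y → X^{(p)}`.
[cite: Ekedahl1987, §1–2 (height-one morphisms of normal varieties ↔ p-closed foliations)] -/
def IsFrobeniusSandwich (p : ℕ) (Y : Scheme.{u}) : Prop :=
  ∃ (X : Scheme.{u}) (f : X ⟶ Y), IsIntegral X ∧ Scheme.IsRegular X ∧ IsFinite f ∧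
    Surjective f ∧ IsPurelyInseparableOfExponent p f

/-! ## API -/

/-- Exponent `1` means: every `f.app V` is surjective. [folklore] -/
theorem isPurelyInseparableOfExponent_one_iff {X Y : Scheme.{u}} (f : X ⟶ Y) :
    IsPurelyInseparableOfExponent 1 f ↔
      ∀ (V : Y.Opens) (a : Γ(X, f ⁻¹ᵁ V)), ∃ b : Γ(Y, V), f.app V b = a := by
  simp [IsPurelyInseparableOfExponent]

/-- The exponent may be replaced by any multiple: `(a ^ r) ^ q = a ^ (r * q)`. [folklore] -/
theorem IsPurelyInseparableOfExponent.of_dvd {q q' : ℕ} {X Y : Scheme.{u}} {f : X ⟶ Y}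
    (h : IsPurelyInseparableOfExponent q f) (hq : q ∣ q') :
    IsPurelyInseparableOfExponent q' f := by
  obtain ⟨r, rfl⟩ := hq
  intro V a
  obtain ⟨b, hb⟩ := h V (a ^ r)
  exact ⟨b, by rw [hb, ← pow_mul, mul_comm]⟩

/-- A purely inseparable alteration of exponent `q` is one of exponent `q'` for every multiple
`q'` of `q`. [folklore] -/
theorem IsPurelyInseparableAlterationOfExponent.of_dvd {q q' : ℕ} {Y X : Scheme.{u}}
    {π : Y ⟶ X} (h : IsPurelyInseparableAlterationOfExponent q π) (hq : q ∣ q') :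
    IsPurelyInseparableAlterationOfExponent q' π := by
  obtain ⟨hp, hs, U, hU, hf, hr⟩ := h
  exact ⟨hp, hs, U, hU, hf, hr.of_dvd hq⟩

end Literature.AlgebraicGeometry.Resolution

end
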